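import Mathlib
import Literature.Analysis.Convex.CellinaSelection
import Literature.Analysis.Convex.SchauderFixedPoint
import HarnessLib

/-!
# Cellina's approximate selection theorem and the Kakutani–Fan fixed point theorem — explicit forms

Literature anchor (statements and proofs follow the source; nothing here is new mathematics).
The two named facts transcribed in `Literature/Analysis/Convex/CellinaSelection.lean` are
discharged in the tree's `Literature/Analysis/Convex/CellinaSelectionProofs.lean`; THIS file
provides the explicit, hypothesis-level forms (approximate selections in witness form, the
closed-versus-USC exercise, and the Kakutani–Fan theorem with closed images / in closed-graph
form) that downstream Literature modules apply directly. Source: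

* [BL00] J. M. Borwein, A. S. Lewis, *Convex Analysis and Nonlinear Optimization. Theory and
  Examples*, CMS Books in Mathematics, Springer (2000), doi:10.1007/978-1-4757-9859-3 (held: `lit`
  key `book:borwein2000-convex-analysis-nonlinear-optimization-theory-examples`), §8.2 "Selection
  and the Kakutani–Fan fixed point theorem", printed pp. 190–192 (PDF pp. 146–148):
  **Thm 8.2.5 (Cellina)** — approximate selections of USC multifunctions with nonempty convex
  images on a compact set; **Exercise 8.2.3 (b), (c)** ("Closed versus USC") — a closed
  multifunction with compact range is USC, a USC multifunction with closed images is closed;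
  **Thm 8.2.2 (Kakutani–Fan)** — a cusco self-multifunction of a nonempty
  compact convex set has a fixed point (bib: BorweinLewis2000).

Original sources: A. Cellina, *Approximation of set valued functions and fixed point theorems*,
Ann. Mat. Pura Appl. (4) 82 (1969) 17–24, Thm 1; S. Kakutani, *A generalization of Brouwer's fixed
point theorem*, Duke Math. J. 8 (1941) 457–459; Ky Fan, *Fixed-point and minimax theorems in
locally convex topological linear spaces*, Proc. Nat. Acad. Sci. USA 38 (1952) 121–126.

Everything is proved; there are no new named facts and no `sorry`.

## What is formalised

* `exists_continuousOn_approxSelection` — **Thm 8.2.5** in the generality the printed proof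
  supports: `K` a compact subset of a (semi)normed group `E`, `Ω : E → Set Y` upper hemicontinuous
  on `K` (Mathlib's `UpperHemicontinuousOn`, = USC of [BL00] p. 190) with nonempty convex images on
  `K`, `Y` a real normed space, `ε > 0`: there is `f : E → Y`, continuous on `K`, with
  `‖x − x'‖ + ‖f x − y'‖ < ε` for some `x' ∈ K`, `y' ∈ Ω x'` (every `x ∈ K`) — inequality (8.2.6)
  for the norm `‖(x, y)‖ = ‖x‖ + ‖y‖` of the printed proof, in witness form — and
  `f x ∈ convexHull ℝ (⋃ z ∈ K, Ω z)` for `x ∈ K`.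
* `mem_of_upperHemicontinuousWithinAt_of_tendsto` — **Exercise 8.2.3 (c)**: if `Ω` is USC at `a`
  within `s`, `Ω a` is closed, `u → a` within `s`, `v → b` and `v i ∈ Ω (u i)` eventually, then
  `b ∈ Ω a` (any topological space `α`, regular space `β`, any filter).
* `exists_mem_self_of_upperHemicontinuousOn` — **Thm 8.2.2** for a real finite-dimensional normed
  space `E`: `C` nonempty compact convex, `Ω` USC on `C` with nonempty closed convex images
  `Ω x ⊆ C` ⟹ `∃ x ∈ C, x ∈ Ω x` (closed images suffice; a cusco has compact ones).
* `upperHemicontinuousOn_of_isClosed_graph` — **Exercise 8.2.3 (b)**: a multifunction with closed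
  graph over `s` and values in a compact set is USC on `s` (any topological spaces); hence
  `exists_mem_self_of_isClosed_graph` — **Thm 8.2.2 in closed-graph form** (Kakutani 1941): `C` nonempty
  compact convex, closed graph over `C`, nonempty convex values `Ω x ⊆ C` ⟹ a fixed point.
* (The named facts `BorweinLewis2000_cellina` / `BorweinLewis2000_kakutaniFan` themselves are
  proved in `CellinaSelectionProofs.lean`, independently; they follow at once from the first and
  third items.)

## Proof transcript and deviations

Thm 8.2.5, as printed: by USC, every `x ∈ K` has `δ_x ∈ (0, ε/2)` with
`Ω(K ∩ (x + δ_x B)) ⊆ Ω(x) + (ε/2) B`; finitely many balls `xᵢ + (δᵢ/2) int B` cover `K`; a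
partition of unity `pᵢ` subordinate to them and points `yᵢ ∈ Ω(xᵢ)` give `f = ∑ pᵢ yᵢ` (8.2.7); for
`x ∈ K` and `I = {i | pᵢ(x) ≠ 0}`, an index `j ∈ I` maximising `δ_j` has `‖x_j − xᵢ‖ < δ_j` for
`i ∈ I`, so every `yᵢ` (`i ∈ I`) lies in the convex set `Ω(x_j) + (ε/2) B`, hence so does `f(x)`,
and `‖x − x_j‖ < δ_j/2`. Deviations: (i) USC is a statement about OPEN sets containing `Ω(x)`, so
we use the open `ε/2`-neighbourhood `Metric.thickening (ε/2) (Ω x)` (convex by `Convex.thickening`)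
where the print writes the closed one — this is what makes (8.2.6) strict; (ii) instead of quoting
Thm 8.2.4 we write the partition of unity down: `pᵢ = wᵢ / ∑ w`, `wᵢ(x) = max (0, δᵢ/2 − ‖x − xᵢ‖)`,
i.e. `f x = Finset.centerMass` of the `yᵢ` with weights `wᵢ(x)` (the same device as the Schauder
projection of `SchauderFixedPoint.lean`); `∑ w > 0` exactly on the union of the balls, which
contains `K`, so `f` is continuous on `K` (values off `K` are irrelevant, as in the named fact).

Thm 8.2.2, as printed: Cellina with `ε = 1/r` gives continuous self-maps `f_r` of `C` (the range
of `f_r` lies in `conv Ω(C) ⊆ C`); Brouwer (8.1.3; in the tree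
`Literature.Analysis.Convex.exists_fixedPoint_of_isCompact_convex`, which takes `ContinuousOn` +
`MapsTo`) gives `x^r = f_r(x^r)`, so `d_{G(Ω)}(x^r, x^r) < 1/r`; a limit point of `(x^r)` (compactness
of `C`, `IsCompact.tendsto_subseq`) is a fixed point because `Ω` is closed (Exercise 8.2.3 (c)).
We use `ε = 1/(r+1)` to avoid `r = 0`.

Dedup (2026-08-24): Mathlib has the hemicontinuity vocabulary but no approximate-selection /
Kakutani / Kakutani–Fan / Ky Fan fixed point theorem (`lean search 'Kakutani'`: Riesz–Markov–
Kakutani and the ergodic Kakutani–Rokhlin lemma only; `'Cellina|approxSelection'`: only the named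
facts); the tree's `CellinaSelection.lean` holds the statements this file proves. Users: the route
item `Summit.AnomalousDissipation.….StirringSphere.HairyBallAlignment` (line `birth`, stub 4) leans
on `BorweinLewis2000_cellina`; the erratum module for Neumaier 1990 §5.3
(`Literature/Analysis/ValidatedNumerics/SetValuedCContinuityErratum.lean`) points to Kakutani–Fan as
the corrected form of Neumaier's Thm 5.3.14.
-/

namespace Literature.Analysis.Convex

open Set Filter Metric
open scoped _root_.Topology

/-! ## Theorem 8.2.5 (Cellina) -/

section Cellina

variable {E Y : Type*} [NormedAddCommGroup E] [NormedAddCommGroup Y] [NormedSpace ℝ Y]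

/-- **Cellina's approximate selection theorem** [BL00, Thm 8.2.5, p. 191]: on a compact set `K`, an
upper hemicontinuous (USC) multifunction `Ω` with nonempty convex images has, for every `ε > 0`, a
continuous approximate selection `f`: `d_{G(Ω)}(x, f x) < ε` on `K` for the norm `‖x‖ + ‖y‖` on
`E × Y` — i.e. some `x' ∈ K`, `y' ∈ Ω x'` have `‖x − x'‖ + ‖f x − y'‖ < ε` — and the range of `f` on
`K` lies in the convex hull of the range of `Ω`. Printed for Euclidean `E`, `Y`; the proof uses only
that `K` is compact in a normed group and `Y` is a real normed space.
[cite: BorweinLewis2000, Thm 8.2.5] -/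
theorem exists_continuousOn_approxSelection {K : Set E} (hK : IsCompact K) {Ω : E → Set Y}
    (hΩ : UpperHemicontinuousOn Ω K) (hne : ∀ x ∈ K, (Ω x).Nonempty)
    (hconv : ∀ x ∈ K, Convex ℝ (Ω x)) {ε : ℝ} (hε : 0 < ε) :
    ∃ f : E → Y, ContinuousOn f K ∧
      (∀ x ∈ K, ∃ x' ∈ K, ∃ y' ∈ Ω x', ‖x - x'‖ + ‖f x - y'‖ < ε) ∧
      ∀ x ∈ K, f x ∈ convexHull ℝ (⋃ z ∈ K, Ω z) := by
  classical
  -- USC radii `δ x ∈ (0, ε/2)` with `Ω z ⊆ (Ω x)_{ε/2}` for `z ∈ K`, `dist z x < δ x` (for `x ∈ K`)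
  have hδ : ∀ x, ∃ δ : ℝ, 0 < δ ∧ δ < ε / 2 ∧
      (x ∈ K → ∀ z ∈ K, dist z x < δ → Ω z ⊆ thickening (ε / 2) (Ω x)) := by
    intro x
    by_cases hx : x ∈ K
    · have hev := (upperHemicontinuousOn_iff_forall_isOpen.1 hΩ) x hx _ isOpen_thickening
        (self_subset_thickening (half_pos hε) (Ω x))
      obtain ⟨r, hr, hrU⟩ := Metric.mem_nhdsWithin_iff.1 hev
      refine ⟨min r (ε / 4), lt_min hr (by positivity), ?_, fun _ z hz hzx => ?_⟩
      · exact (min_le_right _ _).trans_lt (by linarith)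
      · exact hrU ⟨mem_ball.2 (hzx.trans_le (min_le_left _ _)), hz⟩
    · exact ⟨ε / 4, by positivity, by linarith, fun h => absurd h hx⟩
  choose δ hδpos hδlt hδU using hδ
  -- a finite subcover of `K` by the balls `ball x (δ x / 2)`, centres in `K`
  obtain ⟨t, htK, hcover⟩ := hK.elim_nhds_subcover (fun x => ball x (δ x / 2))
    (fun x _ => ball_mem_nhds x (half_pos (hδpos x)))
  have hcov : ∀ z ∈ K, ∃ c ∈ t, dist z c < δ c / 2 := fun z hz => by
    simpa only [mem_iUnion, mem_ball, exists_prop] using hcover hz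
  -- points `y c ∈ Ω c` (for `c ∈ K`)
  have hy : ∀ x, ∃ y : Y, x ∈ K → y ∈ Ω x := fun x => by
    by_cases hx : x ∈ K
    · obtain ⟨y, hy⟩ := hne x hx
      exact ⟨y, fun _ => hy⟩
    · exact ⟨0, fun h => absurd h hx⟩
  choose y hyΩ using hy
  -- the weights of the partition of unity
  set w : E → E → ℝ := fun c z => max 0 (δ c / 2 - dist z c) with hw
  have hw_nonneg : ∀ c z, 0 ≤ w c z := fun c z => le_max_left _ _
  have hw_cont : ∀ c, Continuous (w c) := fun c =>
    continuous_const.max (continuous_const.sub (continuous_id.dist continuous_const))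
  have hw_pos_iff : ∀ c z, 0 < w c z ↔ dist z c < δ c / 2 := fun c z => by
    simp only [hw, lt_max_iff, lt_self_iff_false, false_or, sub_pos]
  have hSpos : ∀ z ∈ K, 0 < ∑ c ∈ t, w c z := fun z hz => by
    obtain ⟨c, hct, hzc⟩ := hcov z hz
    exact Finset.sum_pos' (fun i _ => hw_nonneg i z) ⟨c, hct, (hw_pos_iff c z).2 hzc⟩
  refine ⟨fun z => t.centerMass (fun c => w c z) y, ?_, ?_, ?_⟩
  · -- continuity on `K`
    have hS : Continuous fun z => ∑ c ∈ t, w c z :=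
      continuous_finsetSum _ fun c _ => hw_cont c
    have hV : Continuous fun z => ∑ c ∈ t, w c z • y c :=
      continuous_finsetSum _ fun c _ => (hw_cont c).smul continuous_const
    show ContinuousOn (fun z => (∑ c ∈ t, w c z)⁻¹ • ∑ c ∈ t, w c z • y c) K
    exact (hS.continuousOn.inv₀ fun z hz => (hSpos z hz).ne').smul hV.continuousOn
  · -- the approximate-selection inequality (8.2.6)
    intro z hz
    set I := t.filter (fun c => w c z ≠ 0) with hI
    have hImem : ∀ c ∈ I, dist z c < δ c / 2 := fun c hc =>
      (hw_pos_iff c z).1 (lt_of_le_of_ne (hw_nonneg c z) (Ne.symm (Finset.mem_filter.1 hc).2))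
    have hIne : I.Nonempty := by
      obtain ⟨c, hct, hzc⟩ := hcov z hz
      exact ⟨c, Finset.mem_filter.2 ⟨hct, ((hw_pos_iff c z).2 hzc).ne'⟩⟩
    obtain ⟨j, hjI, hjmax⟩ := I.exists_max_image δ hIne
    have hjK : j ∈ K := htK j (Finset.mem_filter.1 hjI).1
    -- every `y c`, `c ∈ I`, lies in the convex open set `(Ω j)_{ε/2}`
    have hU : ∀ c ∈ I, y c ∈ thickening (ε / 2) (Ω j) := by
      intro c hc
      have hcK : c ∈ K := htK c (Finset.mem_filter.1 hc).1
      have hdist : dist c j < δ j := by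
        calc dist c j ≤ dist c z + dist z j := dist_triangle _ _ _
          _ < δ c / 2 + δ j / 2 := by
            rw [dist_comm c z]; exact add_lt_add (hImem c hc) (hImem j hjI)
          _ ≤ δ j / 2 + δ j / 2 := by gcongr; exact hjmax c hc
          _ = δ j := by ring
      exact hδU j hjK c hcK hdist (hyΩ c hcK)
    have hmem : t.centerMass (fun c => w c z) y ∈ thickening (ε / 2) (Ω j) := by
      rw [← Finset.centerMass_filter_ne_zero]
      exact ((hconv j hjK).thickening _).centerMass_mem (fun c _ => hw_nonneg c z)
        (Finset.sum_pos' (fun c _ => hw_nonneg c z)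
          ⟨j, hjI, (hw_pos_iff j z).2 (hImem j hjI)⟩) hU
    obtain ⟨y', hy', hdy⟩ := mem_thickening_iff.1 hmem
    refine ⟨j, hjK, y', hy', ?_⟩
    have h1 : ‖z - j‖ < ε / 4 := by
      rw [← dist_eq_norm]; linarith [hImem j hjI, hδlt j]
    have h2 : ‖t.centerMass (fun c => w c z) y - y'‖ < ε / 2 := by rwa [← dist_eq_norm]
    linarith
  · -- the range of `f` on `K` lies in `conv (range Ω)`
    intro z hz
    exact Finset.centerMass_mem_convexHull _ (fun c _ => hw_nonneg c z) (hSpos z hz)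
      fun c hc => mem_iUnion₂.2 ⟨c, htK c hc, hyΩ c (htK c hc)⟩

end Cellina

/-! ## Exercise 8.2.3 (c): USC multifunctions with closed images are closed -/

/-- [BL00, §8.2 Exercise 3 (c) "Closed versus USC", p. 193; used on p. 192]: an upper
hemicontinuous multifunction with closed images is *closed* — if `Ω` is USC at `a` within `s`,
`Ω a` is closed, `u → a` within `s`, `v → b`, and `v i ∈ Ω (u i)` eventually, then `b ∈ Ω a`.
(Any topological space `α`, regular space `β`.) [cite: BorweinLewis2000, §8.2 Exercise 3(c)] -/
theorem mem_of_upperHemicontinuousWithinAt_of_tendsto {α β ι : Type*} [TopologicalSpace α]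
    [TopologicalSpace β] [RegularSpace β] {Ω : α → Set β} {s : Set α} {a : α}
    (hΩ : UpperHemicontinuousWithinAt Ω s a) (hcl : IsClosed (Ω a)) {l : Filter ι} [l.NeBot]
    {u : ι → α} {v : ι → β} {b : β} (hu : Tendsto u l (𝓝[s] a)) (hv : Tendsto v l (𝓝 b))
    (huv : ∀ᶠ i in l, v i ∈ Ω (u i)) : b ∈ Ω a := by
  by_contra hb
  have hdisj : Disjoint (𝓝ˢ (Ω a)) (𝓝 b) := disjoint_nhdsSet_nhds.2 (by rwa [hcl.closure_eq])
  obtain ⟨U, hU, V, hV, hUV⟩ := Filter.disjoint_iff.1 hdisj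
  have h1 : ∀ᶠ i in l, U ∈ 𝓝ˢ (Ω (u i)) := hu.eventually (hΩ U hU)
  have h2 : ∀ᶠ i in l, v i ∈ V := hv hV
  obtain ⟨i, hi1, hi2, hi3⟩ := (h1.and (h2.and huv)).exists
  exact Set.disjoint_left.1 hUV (subset_of_mem_nhdsSet hi1 hi3) hi2

/-! ## Exercise 8.2.3 (b): closed multifunctions with compact range are USC -/

/-- [BL00, §8.2 Exercise 3 (b), p. 193]: "any closed multifunction with compact range is USC" — if the
graph `{(x, y) | x ∈ s, y ∈ Ω x}` of `Ω` over `s` is closed and the values `Ω x` (`x ∈ s`) lie in a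
compact set `T`, then `Ω` is upper hemicontinuous on `s`. (Any topological spaces; proof: for an open
`U ⊇ Ω a` the projection of the closed set `graph ∩ (α × (T ∖ U))` along the compact factor `T` is
closed and misses `a`.) [cite: BorweinLewis2000, §8.2 Exercise 3(b)] -/
theorem upperHemicontinuousOn_of_isClosed_graph {α β : Type*} [TopologicalSpace α]
    [TopologicalSpace β] {Ω : α → Set β} {s : Set α} {T : Set β} (hT : IsCompact T)
    (hgraph : IsClosed {p : α × β | p.1 ∈ s ∧ p.2 ∈ Ω p.1}) (hsub : ∀ x ∈ s, Ω x ⊆ T) :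
    UpperHemicontinuousOn Ω s := by
  refine upperHemicontinuousOn_iff_forall_isOpen.2 fun a _ U hU haU => ?_
  haveI : CompactSpace T := isCompact_iff_compactSpace.1 hT
  set S : Set (α × T) :=
    {q | (q.1, (q.2 : β)) ∈ {p : α × β | p.1 ∈ s ∧ p.2 ∈ Ω p.1} ∧ (q.2 : β) ∉ U} with hS_def
  have hval : Continuous fun q : α × T => (q.2 : β) := continuous_subtype_val.comp continuous_snd
  have hS : IsClosed S :=
    (hgraph.preimage (continuous_fst.prodMk hval)).inter (hU.isClosed_compl.preimage hval)
  have hP : IsClosed (Prod.fst '' S) := isClosedMap_fst_of_compactSpace _ hS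
  have haP : a ∉ Prod.fst '' S := by
    rintro ⟨q, ⟨hq, hqU⟩, hqa⟩
    rw [← hqa] at haU
    exact hqU (haU hq.2)
  have hev : ∀ᶠ z in 𝓝 a, z ∉ Prod.fst '' S := hP.isOpen_compl.mem_nhds haP
  refine eventually_nhdsWithin_iff.2 (hev.mono fun z hz hzs y hy => ?_)
  by_contra hyU
  exact hz ⟨(z, ⟨y, hsub z hzs hy⟩), ⟨⟨hzs, hy⟩, hyU⟩, rfl⟩

/-! ## Theorem 8.2.2 (Kakutani–Fan) -/

section KakutaniFan

variable {E : Type*} [NormedAddCommGroup E] [NormedSpace ℝ E] [FiniteDimensional ℝ E]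

/-- **Kakutani–Fan fixed point theorem** [BL00, Thm 8.2.2, p. 191]: if `C ⊆ E` is nonempty,
compact and convex and `Ω : C → C` is a cusco (USC with nonempty compact convex images
`Ω x ⊆ C`), then `Ω` has a fixed point `x ∈ Ω x`. Proved as printed (Cellina 8.2.5 + Brouwer
8.1.3 + closedness of `Ω`); stated for a finite-dimensional real normed space and with *closed*
(rather than compact) images, which is all the printed proof uses.
[cite: BorweinLewis2000, Thm 8.2.2] -/
theorem exists_mem_self_of_upperHemicontinuousOn {C : Set E} (hCne : C.Nonempty)
    (hC : IsCompact C) (hCconv : Convex ℝ C) {Ω : E → Set E} (hΩ : UpperHemicontinuousOn Ω C)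
    (hne : ∀ x ∈ C, (Ω x).Nonempty) (hcl : ∀ x ∈ C, IsClosed (Ω x))
    (hconv : ∀ x ∈ C, Convex ℝ (Ω x)) (hsub : ∀ x ∈ C, Ω x ⊆ C) : ∃ x ∈ C, x ∈ Ω x := by
  classical
  -- Cellina + Brouwer: `x r = f_r (x r)` with `d_{G(Ω)}(x r, x r) < 1/(r+1)`
  have hfix : ∀ r : ℕ, ∃ x ∈ C, ∃ x' ∈ C, ∃ y' ∈ Ω x',
      ‖x - x'‖ + ‖x - y'‖ < 1 / ((r : ℝ) + 1) := by
    intro r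
    obtain ⟨f, hfc, happ, hrange⟩ := exists_continuousOn_approxSelection hC hΩ hne hconv
      (by positivity : (0 : ℝ) < 1 / ((r : ℝ) + 1))
    have hmaps : MapsTo f C C := fun x hx =>
      (convexHull_min (iUnion₂_subset fun z hz => hsub z hz) hCconv) (hrange x hx)
    obtain ⟨x, hxC, hfx⟩ := exists_fixedPoint_of_isCompact_convex hC hCconv hCne ⊤
      (fun _ _ => Submodule.mem_top) hfc hmaps
    obtain ⟨x', hx'C, y', hy', hlt⟩ := happ x hxC
    exact ⟨x, hxC, x', hx'C, y', hy', by simpa only [hfx] using hlt⟩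
  choose x hxC x' hx'C y' hy'Ω hlt using hfix
  -- a convergent subsequence `x (φ n) → a ∈ C`
  obtain ⟨a, haC, φ, hφ, hxa⟩ := hC.tendsto_subseq hxC
  refine ⟨a, haC, ?_⟩
  -- `1/(φ n + 1) → 0`, hence `x' (φ n) → a` and `y' (φ n) → a`
  have hbound : ∀ n, 1 / ((φ n : ℝ) + 1) ≤ 1 / ((n : ℝ) + 1) := fun n =>
    one_div_le_one_div_of_le (by positivity) (by exact_mod_cast Nat.succ_le_succ (hφ.id_le n))
  have hx'a : Tendsto (fun n => x' (φ n)) atTop (𝓝 a) := by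
    refine hxa.congr_dist (squeeze_zero (fun n => dist_nonneg) (fun n => ?_)
      tendsto_one_div_add_atTop_nhds_zero_nat)
    calc dist ((x ∘ φ) n) (x' (φ n)) = ‖x (φ n) - x' (φ n)‖ := dist_eq_norm _ _
      _ ≤ ‖x (φ n) - x' (φ n)‖ + ‖x (φ n) - y' (φ n)‖ := le_add_of_nonneg_right (norm_nonneg _)
      _ ≤ 1 / ((n : ℝ) + 1) := ((hlt (φ n)).trans_le (hbound n)).le
  have hy'a : Tendsto (fun n => y' (φ n)) atTop (𝓝 a) := by
    refine hxa.congr_dist (squeeze_zero (fun n => dist_nonneg) (fun n => ?_)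
      tendsto_one_div_add_atTop_nhds_zero_nat)
    calc dist ((x ∘ φ) n) (y' (φ n)) = ‖x (φ n) - y' (φ n)‖ := dist_eq_norm _ _
      _ ≤ ‖x (φ n) - x' (φ n)‖ + ‖x (φ n) - y' (φ n)‖ := le_add_of_nonneg_left (norm_nonneg _)
      _ ≤ 1 / ((n : ℝ) + 1) := ((hlt (φ n)).trans_le (hbound n)).le
  -- `Ω` is closed (Exercise 8.2.3 (c))
  exact mem_of_upperHemicontinuousWithinAt_of_tendsto (hΩ a haC) (hcl a haC)
    (tendsto_nhdsWithin_iff.2 ⟨hx'a, Eventually.of_forall fun n => hx'C (φ n)⟩) hy'a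
    (Eventually.of_forall fun n => hy'Ω (φ n))

/-- **Kakutani's fixed point theorem, closed-graph form** ([BL00, Thm 8.2.2] combined with [BL00, §8.2
Exercise 3 (b)]; Kakutani 1941): `C` nonempty compact convex in a finite-dimensional real normed space,
`Ω` with closed graph over `C` and nonempty convex values `Ω x ⊆ C` ⟹ `∃ x ∈ C, x ∈ Ω x`.
[cite: BorweinLewis2000, Thm 8.2.2] -/
theorem exists_mem_self_of_isClosed_graph {C : Set E} (hCne : C.Nonempty) (hC : IsCompact C)
    (hCconv : Convex ℝ C) {Ω : E → Set E} (hgraph : IsClosed {p : E × E | p.1 ∈ C ∧ p.2 ∈ Ω p.1})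
    (hne : ∀ x ∈ C, (Ω x).Nonempty) (hconv : ∀ x ∈ C, Convex ℝ (Ω x))
    (hsub : ∀ x ∈ C, Ω x ⊆ C) : ∃ x ∈ C, x ∈ Ω x := by
  refine exists_mem_self_of_upperHemicontinuousOn hCne hC hCconv
    (upperHemicontinuousOn_of_isClosed_graph hC hgraph hsub) hne (fun x hx => ?_) hconv hsub
  -- the value `Ω x` is the slice of the closed graph at `x ∈ C`
  have h : IsClosed ((fun y : E => (x, y)) ⁻¹' {p : E × E | p.1 ∈ C ∧ p.2 ∈ Ω p.1}) :=
    hgraph.preimage (continuous_const.prodMk continuous_id)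
  convert h using 1
  ext y
  simp [hx]

end KakutaniFan

end Literature.Analysis.Convex
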